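import Mathlib
import Summits.MatrixMultiplication.MatrixMultiplication.Theses.HiddenToeplitzCorners

/-!
# Stub `stub_corner_singular` — the corner criterion (`CornerCriterion`, stmt-MatrixMultiplication-7494)

If `E ∈ ℂ^(N × r)` has rank `r` and `T(X) E = F X` for every `X`, then `T(X)` is singular whenever
`X` is: a nonzero kernel vector `v` of `X` gives the kernel vector `E v` of `T(X)`, which is nonzero
because `E` has full column rank.
-/

set_option linter.dupNamespace false

namespace Summit.MatrixMultiplication.MatrixMultiplication.Cruxes.HiddenCorners.Sketch

open Summit.MatrixMultiplication.MatrixMultiplication.Theses.HiddenToeplitzCorners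
open scoped BigOperators Matrix

/-- A matrix `E : ℂ^(N × r)` of full column rank `r` has trivial kernel: `E *ᵥ v = 0` forces `v = 0`
(rank–nullity for `E.mulVecLin` on `Fin r → ℂ`, whose dimension is `r`). -/
private theorem eq_zero_of_rank_eq_of_mulVec_eq_zero {r N : ℕ} (E : Matrix (Fin N) (Fin r) ℂ)
    (hE : E.rank = r) (v : Fin r → ℂ) (hv : E *ᵥ v = 0) : v = 0 := by
  have hker : LinearMap.ker E.mulVecLin = ⊥ := by
    have h := LinearMap.finrank_range_add_finrank_ker E.mulVecLin
    have hr : Module.finrank ℂ (LinearMap.range E.mulVecLin) = r := hE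
    rw [Module.finrank_fin_fun, hr] at h
    have h0 : Module.finrank ℂ (LinearMap.ker E.mulVecLin) = 0 := by omega
    exact Submodule.finrank_eq_zero.mp h0
  have hmem : v ∈ LinearMap.ker E.mulVecLin := by
    rw [LinearMap.mem_ker, Matrix.mulVecLin_apply, hv]
  rw [hker, Submodule.mem_bot] at hmem
  exact hmem

/-- **Corner criterion** (support item stmt-MatrixMultiplication-7494, the route decl
`CornerCriterion`): if `E ∈ ℂ^(N × r)` has rank `r` and the pencil `T(X) = ∑ X a b • T a b`
satisfies `T(X) E = F X` for all `X`, then `det X = 0` implies `det T(X) = 0`.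
Proof: pick `v ≠ 0` with `X v = 0`; then `T(X) (E v) = F (X v) = 0` and `E v ≠ 0` since `E` has
full column rank, so `T(X)` has a nonzero kernel vector. -/
theorem stub_corner_singular : CornerCriterion := by
  intro r N T E F hE hcorner X hX
  obtain ⟨v, hv0, hXv⟩ := Matrix.exists_mulVec_eq_zero_iff.mpr hX
  refine Matrix.exists_mulVec_eq_zero_iff.mp ⟨E *ᵥ v, ?_, ?_⟩
  · intro hEv
    exact hv0 (eq_zero_of_rank_eq_of_mulVec_eq_zero E hE v hEv)
  · rw [Matrix.mulVec_mulVec, hcorner X, ← Matrix.mulVec_mulVec, hXv, Matrix.mulVec_zero]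

end Summit.MatrixMultiplication.MatrixMultiplication.Cruxes.HiddenCorners.Sketch
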